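import Mathlib
import Summits.ValiantsHypothesis.ValiantsHypothesis.Theorems.NewtonUnitEquationsNewtonTauWeakCornerDefs

/-!
# `NewtonTauWeak` (stmt-ValiantsHypothesis-5904): objects of the `K = 3` fixed-coincidence rung (siege stub
# `fixedKCoincidence_t2_K3`, line `binomial-normal-form`)

Route-posited objects (D-0016 `…Defs` file) for the proof of the planner's sub-stub `fixedKCoincidence_t2_K3` of the
crux `Summit.ValiantsHypothesis.ValiantsHypothesis.Theses.NewtonUnitEquations.NewtonTauWeak` (KPTT arXiv:1308.2286
Conj. 1, weak form; first open rung `K = 3`, `t = 2`, coinciding subset sums, under "no short 2-vs-1 direction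
relations", `Cruxes/NewtonTauWeak/Lines/binomial-normal-form-ltc.md` §2–§8, lead c2).  The global-to-local analysis
near a corner of the Newton polygon runs in the Laurent ring `L = ℂ[ℤ²]`, over the weight `wt`, words `push`,
separated coefficients `sepCoeff`, box `box` and `OnRay` of the corner model (`…CornerDefs.lean`).  Objects:
* Laurent model: `L`, monomials `T z`, initial exponents `IsInit`, weight-bounded supports `LowWt`, unit-like
  elements `UnitLike`, separated products `sepProd E P = Π_e P_e(T^{E_e})`, first differing index `fd A B`;
* exponent list `d : Fin N → ℕ²`: integer exponents `toZ`, `gcd` `dg`, primitive vectors `prim`, the direction set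
  `dirSet` enumerated by `dirOf`, orientation `sgnW`/`Edir` (directions of NEGATIVE `w`-weight, so the corner
  convention applies to `-w`), multiplicities `Mdir`;
* the flip (ltc.md §2): `toZHom`, the embedding `iota : ℂ[X,Y] → L`, flipped roots `rhoFlip`, local univariate
  polynomials `PlocB`/`Ploc`, flipped exponent sets `Aset`, corners `corner`, corner coefficients `acoef`;
* charts of weights `(σ, t)`: breakpoints `tau`, cell positivity `PosO`, cell corners `cornerO`, the pair-candidate
  index type `PairIdx` with `sgnB`, `pairPt`.
Everything is a definition or a one-line API lemma [folklore]; users: `…NewtonTauWeakK10{Laurent,Ray,Shifted,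
ThreeFold,Local,Dirs,Flip,Count}.lean` (siege k10).
-/

-- the namespace mandated for this Theorems file repeats the component `ValiantsHypothesis`
set_option linter.dupNamespace false

noncomputable section

open scoped BigOperators Polynomial
open Summit.ValiantsHypothesis.ValiantsHypothesis.Theorems.NewtonTauWeakCorner

namespace Summit.ValiantsHypothesis.ValiantsHypothesis.Theorems.NewtonTauWeakK10

/-- The Laurent polynomial ring `ℂ[ℤ²]` in two variables. [folklore] -/
abbrev L : Type := AddMonoidAlgebra ℂ (Fin 2 → ℤ)

/-- The Laurent monomial `T^z`. [folklore] -/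
def T (z : Fin 2 → ℤ) : L := AddMonoidAlgebra.single z 1

/-- `v` is THE `w`-initial exponent of `x`: a support point strictly lighter than every other one. [folklore] -/
def IsInit (w : Fin 2 → ℝ) (x : L) (v : Fin 2 → ℤ) : Prop :=
  x.coeff v ≠ 0 ∧ ∀ z, x.coeff z ≠ 0 → z ≠ v → wt w v < wt w z

/-- Every support point of `x` weighs at least `μ`. [folklore] -/
def LowWt (w : Fin 2 → ℝ) (x : L) (μ : ℝ) : Prop := ∀ z, x.coeff z ≠ 0 → μ ≤ wt w z

/-- `y` is UNIT-LIKE for `w`: constant coefficient `1`, every other support point of positive weight. [folklore] -/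
def UnitLike (w : Fin 2 → ℝ) (y : L) : Prop := y.coeff 0 = 1 ∧ ∀ z, y.coeff z ≠ 0 → z ≠ 0 → 0 < wt w z

/-- The separated product `Π_e P_e(T^{E_e})` of univariate polynomials along the directions `E`. [folklore] -/
def sepProd {s : ℕ} (E : Fin s → Fin 2 → ℤ) (P : Fin s → ℂ[X]) : L :=
  ∏ e, Polynomial.aeval (T (E e)) (P e)

/-- Two distinct polynomials differ in some coefficient. [folklore] -/
theorem exists_coeff_ne_of_ne {A B : ℂ[X]} (h : A ≠ B) : ∃ k, A.coeff k ≠ B.coeff k := by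
  by_contra hall
  push Not at hall
  exact h (Polynomial.ext hall)

open Classical in
/-- `fd A B`: the least index at which the coefficients of `A` and `B` differ (`0` if `A = B`). [folklore] -/
def fd (A B : ℂ[X]) : ℕ := if h : A = B then 0 else Nat.find (exists_coeff_ne_of_ne h)

/-- The integer exponent vector of an exponent `e ∈ ℕ²`. [folklore] -/
def toZ (e : Fin 2 →₀ ℕ) : Fin 2 → ℤ := fun i => (e i : ℤ)

/-- Coordinates of `toZ`. [folklore] -/
@[simp] theorem toZ_apply (e : Fin 2 →₀ ℕ) (i : Fin 2) : toZ e i = (e i : ℤ) := rfl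

/-- `toZ` is additive. [folklore] -/
theorem toZ_add (a b : Fin 2 →₀ ℕ) : toZ (a + b) = toZ a + toZ b := by
  funext i; simp [toZ]

/-- `toZ 0 = 0`. [folklore] -/
@[simp] theorem toZ_zero : toZ 0 = 0 := by funext i; simp [toZ]

/-- The gcd of the two coordinates of an exponent. [folklore] -/
def dg (e : Fin 2 →₀ ℕ) : ℕ := Nat.gcd (e 0) (e 1)

/-- The primitive vector of an exponent: `e / gcd(e₀, e₁)` (junk `0` for `e = 0`). [folklore] -/
def prim (e : Fin 2 →₀ ℕ) : Fin 2 → ℤ := fun i => ((e i / dg e : ℕ) : ℤ)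

variable {N : ℕ}

/-- The set of primitive directions of the nonzero exponents of the list. [folklore] -/
def dirSet (d : Fin N → (Fin 2 →₀ ℕ)) : Finset (Fin 2 → ℤ) :=
  (Finset.univ.filter fun j => d j ≠ 0).image fun j => prim (d j)

/-- The `e`-th primitive direction (an enumeration of `dirSet d` by `Fin s`, `s = #dirSet d`). [folklore] -/
def dirOf (d : Fin N → (Fin 2 →₀ ℕ)) (e : Fin (dirSet d).card) : Fin 2 → ℤ := ((dirSet d).equivFin.symm e).1

/-- The orientation sign making the weight negative: `-1` if `⟨w, y⟩ > 0`, else `1`. [folklore] -/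
def sgnW (w : Fin 2 → ℝ) (y : Fin 2 → ℤ) : ℤ := if 0 < wt w y then -1 else 1

/-- The oriented local directions `E_e = ∓ dirOf e`, of NEGATIVE `w`-weight. [folklore] -/
def Edir (d : Fin N → (Fin 2 →₀ ℕ)) (w : Fin 2 → ℝ) (e : Fin (dirSet d).card) : Fin 2 → ℤ :=
  sgnW w (dirOf d e) • dirOf d e

/-- The multiplicity of the `e`-th direction: total `gcd`-mass of the exponents on that line. [folklore] -/
def Mdir (d : Fin N → (Fin 2 →₀ ℕ)) (e : Fin (dirSet d).card) : ℕ :=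
  ∑ j ∈ Finset.univ.filter (fun j => d j ≠ 0 ∧ prim (d j) = dirOf d e), dg (d j)

/-- `toZ` as an additive homomorphism. [folklore] -/
def toZHom : (Fin 2 →₀ ℕ) →+ (Fin 2 → ℤ) where
  toFun := toZ
  map_zero' := toZ_zero
  map_add' := toZ_add

/-- The embedding `ℂ[X,Y] → ℂ[ℤ²]`. [folklore] -/
def iota : MvPolynomial (Fin 2) ℂ →+* L := AddMonoidAlgebra.mapDomainRingHom ℂ toZHom

/-- The flipped root: `ρ⁻¹` on a flipped (positively weighted) line, `ρ` otherwise. [folklore] -/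
def rhoFlip (b : Bool) (ρ : ℂ) : ℂ := if b then ρ⁻¹ else ρ

/-- The local univariate polynomial of product `l` along the primitive direction `y` with flip bit `b`:
`Π_{j : d_j ≠ 0, prim d_j = y, ρ_{lj} ≠ 0} (1 − ρ̂_{lj} s^{gcd(d_j)})`. [this line's normal form] -/
def PlocB (ρ : Fin 3 → Fin N → ℂ) (d : Fin N → (Fin 2 →₀ ℕ)) (b : Bool) (l : Fin 3) (y : Fin 2 → ℤ) : ℂ[X] :=
  ∏ j ∈ Finset.univ.filter (fun j => d j ≠ 0 ∧ prim (d j) = y ∧ ρ l j ≠ 0),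
    (1 - Polynomial.C (rhoFlip b (ρ l j)) * Polynomial.X ^ dg (d j))

/-- The flip bit of a direction: is its `w`-weight positive? [folklore] -/
def flipBit (w : Fin 2 → ℝ) (y : Fin 2 → ℤ) : Bool := decide (0 < wt w y)

/-- The local univariate polynomials of product `l` for the weight `w`, indexed by the enumerated directions.
[this line's normal form] -/
def Ploc (ρ : Fin 3 → Fin N → ℂ) (d : Fin N → (Fin 2 →₀ ℕ)) (w : Fin 2 → ℝ) (l : Fin 3)
    (e : Fin (dirSet d).card) : ℂ[X] :=
  PlocB ρ d (flipBit w (dirOf d e)) l (dirOf d e)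

/-- The exponents flipped in product `l`: positive weight and nonzero root. [folklore] -/
def Aset (ρ : Fin 3 → Fin N → ℂ) (d : Fin N → (Fin 2 →₀ ℕ)) (w : Fin 2 → ℝ) (l : Fin 3) : Finset (Fin N) :=
  Finset.univ.filter fun j => 0 < wt w (toZ (d j)) ∧ ρ l j ≠ 0

/-- The `w`-top corner of product `l`: the sum of its flipped exponents. [folklore] -/
def corner (ρ : Fin 3 → Fin N → ℂ) (d : Fin N → (Fin 2 →₀ ℕ)) (w : Fin 2 → ℝ) (l : Fin 3) : Fin 2 → ℤ :=
  ∑ j ∈ Aset ρ d w l, toZ (d j)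

/-- The corner coefficient of product `l`. [folklore] -/
def acoef (c : Fin 3 → ℂ) (ρ : Fin 3 → Fin N → ℂ) (d : Fin N → (Fin 2 →₀ ℕ)) (w : Fin 2 → ℝ) (l : Fin 3) : ℂ :=
  c l * (∏ j ∈ Finset.univ.filter (fun j => d j = 0), (1 - ρ l j)) * ∏ j ∈ Aset ρ d w l, (-ρ l j)

/-- The breakpoint of exponent `j` along the chart `(σ, t)`: for `(d_j)_1 ≠ 0`, `⟨(σ,t), d_j⟩ > 0 ⇔ t > τ_j`.
[folklore] -/
def tau (d : Fin N → (Fin 2 →₀ ℕ)) (σ : ℝ) (j : Fin N) : ℝ := -σ * (d j 0 : ℝ) / (d j 1 : ℝ)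

/-- Positivity of exponent `j` in the cell labelled by `o` along the chart `σ`. [folklore] -/
def PosO (d : Fin N → (Fin 2 →₀ ℕ)) (σ : ℝ) (o : Option (Fin N)) (j : Fin N) : Prop :=
  (d j 1 = 0 ∧ 0 < σ * (d j 0 : ℝ)) ∨ (d j 1 ≠ 0 ∧ ∀ j₀, o = some j₀ → tau d σ j < tau d σ j₀)

open Classical in
/-- The corner of product `l` in the cell labelled by `o` along the chart `σ`. [folklore] -/
def cornerO (ρ : Fin 3 → Fin N → ℂ) (d : Fin N → (Fin 2 →₀ ℕ)) (σ : ℝ) (l : Fin 3) (o : Option (Fin N)) :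
    Fin 2 → ℤ :=
  ∑ j ∈ Finset.univ.filter (fun j => PosO d σ o j ∧ ρ l j ≠ 0), toZ (d j)

/-- The index type of the pair candidates. [folklore] -/
abbrev PairIdx (N : ℕ) : Type :=
  (Fin 3 × Option (Fin N)) × (Fin N × Fin N) × (Bool × Bool) × (Bool × Bool) × ((Fin 3 × Fin 3) × (Fin 3 × Fin 3))

/-- The sign attached to a boolean. [folklore] -/
def sgnB (b : Bool) : ℤ := if b then 1 else -1

/-- The pair candidate point of an index. [folklore] -/
def pairPt (ρ : Fin 3 → Fin N → ℂ) (d : Fin N → (Fin 2 →₀ ℕ)) (σ : ℝ) (i : PairIdx N) : Fin 2 → ℤ :=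
  cornerO ρ d σ i.1.1 i.1.2 +
    (sgnB i.2.2.1.1 * fd (PlocB ρ d i.2.2.2.1.1 i.2.2.2.2.1.1 (prim (d i.2.1.1)))
      (PlocB ρ d i.2.2.2.1.1 i.2.2.2.2.1.2 (prim (d i.2.1.1)))) • prim (d i.2.1.1) +
    (sgnB i.2.2.1.2 * fd (PlocB ρ d i.2.2.2.1.2 i.2.2.2.2.2.1 (prim (d i.2.1.2)))
      (PlocB ρ d i.2.2.2.1.2 i.2.2.2.2.2.2 (prim (d i.2.1.2)))) • prim (d i.2.1.2)

end Summit.ValiantsHypothesis.ValiantsHypothesis.Theorems.NewtonTauWeakK10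

end
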